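import Mathlib
import Summits.MatrixMultiplication.MatrixMultiplication.Theses.LevelGradedCohnUmans
import Summits.MatrixMultiplication.MatrixMultiplication.Theorems.LieRankDesigns.Negative.Basics

/-!
# Stub `stub_tpp_iff_sandwich` — line `Sketch` of the crux `LevelOneGL2Designs`
(stmt-MatrixMultiplication-14080)

The folklore "quotient-set sandwich" reformulation of the quadruple-form triple product
property: for non-empty `Y`,

  `(∀ x₀ z₀ x y y' z, x⁻¹ y y'⁻¹ z = x₀⁻¹ z₀ → x = x₀ ∧ y = y' ∧ z = z₀)`
  `↔ (Q(X) ∩ Q(Z) = {1}) ∧ (Q(Y) ∩ Q(X)·Q(Z) = {1})`, where `Q(S) = S·S⁻¹`,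

both intersections being written pointwise.  Pure group algebra (Mathlib's `group` tactic).
-/

set_option linter.dupNamespace false

noncomputable section

open scoped BigOperators

namespace Summit.MatrixMultiplication.MatrixMultiplication.Theorems.LevelOneGL2Designs.FlagLine

open Summit.MatrixMultiplication.MatrixMultiplication.Theses.LevelGradedCohnUmans
open Summit.MatrixMultiplication.MatrixMultiplication.Theorems.LieRankDesigns.Negative

section Sandwich

variable {G : Type} [Group G] [DecidableEq G]

-- The skeleton's `variable` line auto-includes `[DecidableEq G]` in the registered signature
-- although the statement does not use it; keep it (exact signature) and silence the linter.
set_option linter.unusedSectionVars false in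
/-- **Quotient-set sandwich.**  The crux's quadruple-form TPP
(`x⁻¹yy'⁻¹z = x₀⁻¹z₀ ⇒ x = x₀ ∧ y = y' ∧ z = z₀`) is equivalent, for non-empty `Y`, to
`Q(X) ∩ Q(Z) = {1}` together with `Q(Y) ∩ Q(X)·Q(Z) = {1}` (`Q(S) = S S⁻¹`), both written
pointwise. [elementary] -/
theorem stub_tpp_iff_sandwich (X Y Z : Finset G) (hY : Y.Nonempty) :
    (∀ x₀ ∈ X, ∀ z₀ ∈ Z, ∀ x ∈ X, ∀ y ∈ Y, ∀ y' ∈ Y, ∀ z ∈ Z,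
        x⁻¹ * y * y'⁻¹ * z = x₀⁻¹ * z₀ → x = x₀ ∧ y = y' ∧ z = z₀) ↔
      ((∀ x ∈ X, ∀ x' ∈ X, ∀ z ∈ Z, ∀ z' ∈ Z, x * x'⁻¹ = z * z'⁻¹ → x = x' ∧ z = z') ∧
        (∀ y ∈ Y, ∀ y' ∈ Y, ∀ x ∈ X, ∀ x' ∈ X, ∀ z ∈ Z, ∀ z' ∈ Z,
          y * y'⁻¹ = (x * x'⁻¹) * (z * z'⁻¹) → y = y')) := by
  constructor
  · intro hT
    refine ⟨?_, ?_⟩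
    · -- `Q(X) ∩ Q(Z) = {1}`: test the quadruple `(x', y, y, z')` against the target `x⁻¹ z`.
      intro x hx x' hx' z hz z' hz' hxz
      obtain ⟨y, hy⟩ := hY
      have h1 : x'⁻¹ = x⁻¹ * (z * z'⁻¹) := by
        rw [← hxz]
        group
      have key : x'⁻¹ * y * y⁻¹ * z' = x⁻¹ * z := by
        rw [h1]
        group
      obtain ⟨hxx, -, hzz⟩ := hT x hx z hz x' hx' y hy y hy z' hz' key
      exact ⟨hxx.symm, hzz.symm⟩
    · -- `Q(Y) ∩ Q(X)Q(Z) = {1}`: test the quadruple `(x, y, y', z')` against the target `x'⁻¹ z`.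
      intro y hy y' hy' x hx x' hx' z hz z' hz' hyy
      have key : x⁻¹ * y * y'⁻¹ * z' = x'⁻¹ * z := by
        calc x⁻¹ * y * y'⁻¹ * z' = x⁻¹ * (y * y'⁻¹) * z' := by group
          _ = x⁻¹ * (x * x'⁻¹ * (z * z'⁻¹)) * z' := by rw [hyy]
          _ = x'⁻¹ * z := by group
      exact (hT x' hx' z hz x hx y hy y' hy' z' hz' key).2.1
  · rintro ⟨hA, hB⟩ x₀ hx₀ z₀ hz₀ x hx y hy y' hy' z hz hq
    -- First `y = y'` by the second condition, then `x = x₀ ∧ z = z₀` by the first.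
    have hyy : y * y'⁻¹ = (x * x₀⁻¹) * (z₀ * z⁻¹) := by
      calc y * y'⁻¹ = x * (x⁻¹ * y * y'⁻¹ * z) * z⁻¹ := by group
        _ = x * (x₀⁻¹ * z₀) * z⁻¹ := by rw [hq]
        _ = (x * x₀⁻¹) * (z₀ * z⁻¹) := by group
    have hy_eq : y = y' := hB y hy y' hy' x hx x₀ hx₀ z₀ hz₀ z hz hyy
    subst hy_eq
    have hq' : x⁻¹ * z = x₀⁻¹ * z₀ := by
      rw [← hq]
      group
    have hxz : x₀ * x⁻¹ = z₀ * z⁻¹ := by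
      calc x₀ * x⁻¹ = x₀ * (x⁻¹ * z) * z⁻¹ := by group
        _ = x₀ * (x₀⁻¹ * z₀) * z⁻¹ := by rw [hq']
        _ = z₀ * z⁻¹ := by group
    obtain ⟨hxx, hzz⟩ := hA x₀ hx₀ x hx z₀ hz₀ z hz hxz
    exact ⟨hxx.symm, rfl, hzz.symm⟩

end Sandwich

end Summit.MatrixMultiplication.MatrixMultiplication.Theorems.LevelOneGL2Designs.FlagLine
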